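import Mathlib
import Literature.NumberTheory.Sieve.LinearPairDivisorShortSums
import Summits.Parity.BatemanHorn.Theorems.PolynomialMobiusPolyMobiusTailStubPairMiddleSmallM

/-!
# Crux `PolyMobiusTail` (stmt-Parity-0870), line `eta-free-multilinear-window`, stub `stub_pair_middle`
# — helper 4: support of the TRUE summand and the small-cofactor part

* `true_summand_support` — the TRUE conditions force `⌊x^{σ₁}⌋₊ < d₀ ≤ ⌊x^{σ₂}⌋₊`, `m ≤ Xb`, `m ≤ 2q₁x^{σ₂+η}`;
* `small_part_le` — from `stub_pair_middle_smallm` and the short-interval divisor bound (TAU) the part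
  `m ≤ ⌊x^{σ₁/2}⌋₊` is `≤ C (1+log x)^{c+2} x^{1−σ₁/4}` for `θ ≤ σ₁/4`.
Head: the registered auxiliary stub `stub_pair_middle_small_part`.
-/

open scoped BigOperators
open Finset Real Filter Polynomial Asymptotics

namespace Summit.Parity.BatemanHorn.Theorems.PolyMobiusTail.EtaFreeWindow

namespace MiddleAssembly

open Literature.NumberTheory.Sieve

/-- **Support of the TRUE summand.**  If the TRUE conditions hold at `(d₀,d₁,m)` then
`⌊x^{σ₁}⌋₊ < d₀ ≤ ⌊x^{σ₂}⌋₊`, `m ≤ Xb = (q₀'+q₁')x + |a₀| + |a₁|` and `m ≤ 2q₁x^{σ₂+η}` (for `x ≥ |a₁|`, `x ≥ 1`). -/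
theorem true_summand_support {q₀ a₀ q₁ a₁ : ℤ} (hq₀ : 0 < q₀) (hq₁ : 0 < q₁) {σ₁ σ₂ θ η : ℝ}
    {x d₀ d₁ m : ℕ} (hx1 : 1 ≤ x) (hax : (a₁.natAbs : ℝ) ≤ x)
    (h : ((d₁ : ℤ) * m - a₁) % q₁ = 0 ∧
        (1 ≤ ((d₁ : ℤ) * m - a₁) / q₁ ∧ ((d₁ : ℤ) * m - a₁) / q₁ ≤ x) ∧
        (1 ≤ q₀ * (((d₁ : ℤ) * m - a₁) / q₁) + a₀ ∧ (d₀ : ℤ) ∣ q₀ * (((d₁ : ℤ) * m - a₁) / q₁) + a₀) ∧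
        ((x : ℝ) ^ (1 - η) < (d₀ : ℝ) * d₁ ∧ (d₀ : ℝ) * d₁ ≤ (x : ℝ) ^ (1 + θ) ∧
          ((x : ℝ) ^ σ₁ < (d₀ : ℝ) ∧ (d₀ : ℝ) ≤ (x : ℝ) ^ σ₂))) :
    ⌊(x : ℝ) ^ σ₁⌋₊ < d₀ ∧ d₀ ≤ ⌊(x : ℝ) ^ σ₂⌋₊ ∧ m ≤ (q₀.toNat + q₁.toNat) * x + a₀.natAbs + a₁.natAbs ∧
      (m : ℝ) ≤ 2 * q₁ * (x : ℝ) ^ (σ₂ + η) := by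
  have hx1R : (1 : ℝ) ≤ x := by exact_mod_cast hx1
  have hx0R : (0 : ℝ) < x := by linarith only [hx1R]
  have hq₁R : (1 : ℝ) ≤ q₁ := by exact_mod_cast hq₁
  obtain ⟨hC1, ⟨hn1, hnx⟩, -, hWlo, -, hd₀l, hd₀u⟩ := h
  set nn : ℤ := ((d₁ : ℤ) * m - a₁) / q₁ with hnn
  have hq : q₁ * nn = (d₁ : ℤ) * m - a₁ := Int.mul_ediv_cancel' (Int.dvd_of_emod_eq_zero hC1)
  have hd₁pos : 0 < d₁ := by
    rcases Nat.eq_zero_or_pos d₁ with h0 | h0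
    · rw [h0] at hWlo; simp at hWlo; linarith only [hWlo, Real.rpow_pos_of_pos hx0R (1 - η)]
    · exact h0
  have hprodZ : (d₁ : ℤ) * m ≤ q₁ * x + |a₁| := by
    have h1 : (d₁ : ℤ) * m = q₁ * nn + a₁ := by linarith only [hq]
    have h2 : q₁ * nn ≤ q₁ * x := mul_le_mul_of_nonneg_left hnx hq₁.le
    have h3 : a₁ ≤ |a₁| := le_abs_self _
    linarith only [h1, h2, h3]
  have hmZ : (m : ℤ) ≤ (d₁ : ℤ) * m := by
    have h1 : (1 : ℤ) ≤ d₁ := by exact_mod_cast hd₁pos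
    have h2 : (0 : ℤ) ≤ m := by positivity
    nlinarith only [h1, h2]
  refine ⟨(Nat.floor_lt (by positivity)).mpr hd₀l, Nat.le_floor hd₀u, ?_, ?_⟩
  · have : (m : ℤ) ≤ ((q₀.toNat + q₁.toNat) * x + a₀.natAbs + a₁.natAbs : ℕ) := by
      have hq₀'Z : ((q₀.toNat : ℕ) : ℤ) = q₀ := Int.toNat_of_nonneg hq₀.le
      have hq₁'Z : ((q₁.toNat : ℕ) : ℤ) = q₁ := Int.toNat_of_nonneg hq₁.le
      push_cast
      rw [hq₀'Z, hq₁'Z]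
      have h1 : (0 : ℤ) ≤ q₀ * x := by positivity
      have h2 : (0 : ℤ) ≤ |a₀| := abs_nonneg _
      linarith only [hmZ, hprodZ, h1, h2]
    exact_mod_cast this
  · have habsR : ((a₁.natAbs : ℕ) : ℝ) = |(a₁ : ℝ)| := by rw [Nat.cast_natAbs, Int.cast_abs]
    have hprodR : (d₁ : ℝ) * m ≤ q₁ * x + |(a₁ : ℝ)| := by
      have := (Int.cast_le (R := ℝ)).mpr hprodZ
      push_cast at this
      exact this
    have h2 : (q₁ : ℝ) * x + |(a₁ : ℝ)| ≤ 2 * q₁ * x := by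
      have h4 : (x : ℝ) ≤ q₁ * x := le_mul_of_one_le_left hx0R.le hq₁R
      have h5 : |(a₁ : ℝ)| ≤ x := habsR ▸ hax
      linarith only [h5, h4]
    have hd₀pos : (0 : ℝ) < d₀ := lt_of_le_of_lt (by positivity) hd₀l
    have hd₁low : (x : ℝ) ^ (1 - η - σ₂) < d₁ := by
      have h3 : (x : ℝ) ^ (1 - η) < (x : ℝ) ^ σ₂ * d₁ := by
        calc (x : ℝ) ^ (1 - η) < (d₀ : ℝ) * d₁ := hWlo
          _ ≤ (x : ℝ) ^ σ₂ * d₁ := mul_le_mul_of_nonneg_right hd₀u (Nat.cast_nonneg _)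
      have h4 : (x : ℝ) ^ (1 - η - σ₂) * (x : ℝ) ^ σ₂ = (x : ℝ) ^ (1 - η) := by
        rw [← Real.rpow_add hx0R]; ring_nf
      by_contra hcon
      push Not at hcon
      have : (x : ℝ) ^ σ₂ * d₁ ≤ (x : ℝ) ^ (1 - η) := by
        rw [← h4]; rw [mul_comm]; exact mul_le_mul_of_nonneg_right hcon (by positivity)
      linarith only [this, h3]
    have hxsplit : (2 : ℝ) * q₁ * x = 2 * q₁ * (x : ℝ) ^ (σ₂ + η) * (x : ℝ) ^ (1 - η - σ₂) := by
      rw [mul_assoc (2 * (q₁ : ℝ)) _ _, ← Real.rpow_add hx0R]; ring_nf; rw [Real.rpow_one]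
    have hmle : (m : ℝ) * (x : ℝ) ^ (1 - η - σ₂) ≤ (d₁ : ℝ) * m := by
      rw [mul_comm]; exact mul_le_mul_of_nonneg_right hd₁low.le (Nat.cast_nonneg _)
    have hpos : (0 : ℝ) < (x : ℝ) ^ (1 - η - σ₂) := by positivity
    have : (m : ℝ) * (x : ℝ) ^ (1 - η - σ₂) ≤ 2 * q₁ * (x : ℝ) ^ (σ₂ + η) * (x : ℝ) ^ (1 - η - σ₂) := by
      rw [← hxsplit]; linarith only [hmle, hprodR, h2]
    exact le_of_mul_le_mul_right this hpos



/-- `1 + log Xb ≤ 3 (1 + log x)` when `1 ≤ Xb ≤ x²` … in the form used below: for `Xb ≤ x ^ 2`,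
`0 < x`, `1 ≤ Xb`. -/
theorem one_add_log_le_three_mul {x Xb : ℕ} (hx : 1 ≤ x) (hXb1 : 1 ≤ Xb) (hXb : (Xb : ℝ) ≤ (x : ℝ) ^ 2) :
    1 + Real.log Xb ≤ 3 * (1 + Real.log x) := by
  have hx0 : (0 : ℝ) < x := by exact_mod_cast hx
  have hXb0 : (0 : ℝ) < Xb := by exact_mod_cast hXb1
  have h1 : Real.log Xb ≤ Real.log ((x : ℝ) ^ 2) := Real.log_le_log hXb0 hXb
  rw [Real.log_pow] at h1
  have h2 : 0 ≤ Real.log x := Real.log_nonneg (by exact_mod_cast hx)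
  push_cast at h1
  linarith

/-- **Small-cofactor part.**  For pair data `qᵢ ≥ 1`, `0 < σ₁`, `θ ≤ σ₁/4`, there are `C` and `c`
such that for all `x ≥ X₀` (with `Xb = (q₀+q₁)x + |a₀| + |a₁|` … any `Xb` with `1 ≤ Xb ≤ x²`) the part
`m ≤ ⌊x^{σ₁/2}⌋₊` of the triple sum is at most `C (1 + log x)^{c+2} x^{1 − σ₁/4}`. -/
theorem small_part_le {q₀ a₀ q₁ a₁ : ℤ} (hq₀ : 0 < q₀) (hq₁ : 0 < q₁) {σ₁ : ℝ} (hσ₁ : 0 < σ₁)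
    (hσ₁' : σ₁ < 1) :
    ∃ C : ℝ, 0 < C ∧ ∃ c : ℕ, ∃ X₀ : ℕ, ∀ (x Xb : ℕ) (σ₂ θ η : ℝ), X₀ ≤ x → θ ≤ σ₁ / 4 →
      1 ≤ Xb → (Xb : ℝ) ≤ (x : ℝ) ^ 2 →
      |∑ d₀ ∈ Finset.Icc 1 Xb, ∑ d₁ ∈ Finset.Icc 1 Xb, ∑ m ∈ Finset.Icc 1 ⌊(x : ℝ) ^ (σ₁ / 2)⌋₊,
          (if ((d₁ : ℤ) * m - a₁) % q₁ = 0 ∧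
              (1 ≤ ((d₁ : ℤ) * m - a₁) / q₁ ∧ ((d₁ : ℤ) * m - a₁) / q₁ ≤ x) ∧
              (1 ≤ q₀ * (((d₁ : ℤ) * m - a₁) / q₁) + a₀ ∧ (d₀ : ℤ) ∣ q₀ * (((d₁ : ℤ) * m - a₁) / q₁) + a₀) ∧
              ((x : ℝ) ^ (1 - η) < (d₀ : ℝ) * d₁ ∧ (d₀ : ℝ) * d₁ ≤ (x : ℝ) ^ (1 + θ) ∧
                ((x : ℝ) ^ σ₁ < (d₀ : ℝ) ∧ (d₀ : ℝ) ≤ (x : ℝ) ^ σ₂)) then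
            ((ArithmeticFunction.moebius d₀ : ℝ) * Real.log d₀) *
              ((ArithmeticFunction.moebius d₁ : ℝ) * Real.log d₁) else 0)| ≤
      C * (1 + Real.log x) ^ (c + 2) * (x : ℝ) ^ (1 - σ₁ / 4) := by
  obtain ⟨Cτ, hCτ, c, hτ⟩ :=
    Literature.NumberTheory.Sieve.LinearPairShells.sum_Ioc_card_divisors_mul_le hq₀ hq₁ a₀ a₁
  -- choice of `X₀`
  have hpos1 : 0 < 1 - σ₁ / 4 := by linarith
  have hpos2 : 0 < σ₁ / 4 := by linarith
  have ht1 : Filter.Tendsto (fun x : ℕ => (x : ℝ) ^ (1 - σ₁ / 4)) Filter.atTop Filter.atTop :=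
    (tendsto_rpow_atTop hpos1).comp tendsto_natCast_atTop_atTop
  have ht2 : Filter.Tendsto (fun x : ℕ => (x : ℝ) ^ (σ₁ / 4)) Filter.atTop Filter.atTop :=
    (tendsto_rpow_atTop hpos2).comp tendsto_natCast_atTop_atTop
  have hev : ∀ᶠ x : ℕ in Filter.atTop, 2 ≤ x ∧ (a₁.natAbs : ℝ) ≤ (x : ℝ) ^ (1 - σ₁ / 4) ∧
      (2 : ℝ) ≤ (x : ℝ) ^ (σ₁ / 4) :=
    (Filter.eventually_ge_atTop 2).and ((ht1.eventually_ge_atTop _).and (ht2.eventually_ge_atTop _))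
  obtain ⟨X₀, hX₀⟩ := Filter.eventually_atTop.mp hev
  refine ⟨36 * Cτ, by positivity, c, X₀, ?_⟩
  intro x Xb σ₂ θ η hx hθ hXb1 hXb2
  obtain ⟨hx2, ha₁, hx4⟩ := hX₀ x hx
  have hx1 : 1 ≤ x := le_trans (by norm_num) hx2
  have hx1R : (1 : ℝ) ≤ x := by exact_mod_cast hx1
  have hx0R : (0 : ℝ) < x := by linarith
  set L : ℝ := 1 + Real.log x with hL
  have hlog0 : 0 ≤ Real.log x := Real.log_nonneg hx1R
  have hL1 : 1 ≤ L := by linarith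
  set M₀ : ℕ := ⌊(x : ℝ) ^ (σ₁ / 2)⌋₊ with hM₀
  set N : ℕ := ⌊(M₀ : ℝ) * (x : ℝ) ^ (1 + θ - σ₁)⌋₊ + a₁.natAbs with hN
  -- Step 1: the counting stub
  have h1 := stub_pair_middle_smallm q₀ a₀ q₁ a₁ σ₁ σ₂ θ η x Xb M₀ hq₀ hq₁ hx1
  refine h1.trans ?_
  -- Step 2: `N ≤ x^{1-σ₁/4} + |a₁| ≤ 2 x^{1-σ₁/4}` and `N' = max N 2`
  have hY : (x : ℝ) ^ (1 - σ₁ / 4) ≤ x := by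
    calc (x : ℝ) ^ (1 - σ₁ / 4) ≤ (x : ℝ) ^ (1 : ℝ) := Real.rpow_le_rpow_of_exponent_le hx1R (by linarith)
      _ = x := Real.rpow_one _
  have hM₀le : (M₀ : ℝ) ≤ (x : ℝ) ^ (σ₁ / 2) := Nat.floor_le (by positivity)
  have hNle : (N : ℝ) ≤ 2 * (x : ℝ) ^ (1 - σ₁ / 4) := by
    have h2 : (⌊(M₀ : ℝ) * (x : ℝ) ^ (1 + θ - σ₁)⌋₊ : ℝ) ≤ (M₀ : ℝ) * (x : ℝ) ^ (1 + θ - σ₁) :=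
      Nat.floor_le (by positivity)
    have h3 : (M₀ : ℝ) * (x : ℝ) ^ (1 + θ - σ₁) ≤ (x : ℝ) ^ (σ₁ / 2) * (x : ℝ) ^ (1 + θ - σ₁) :=
      mul_le_mul_of_nonneg_right hM₀le (by positivity)
    have h4 : (x : ℝ) ^ (σ₁ / 2) * (x : ℝ) ^ (1 + θ - σ₁) = (x : ℝ) ^ (1 + θ - σ₁ / 2) := by
      rw [← Real.rpow_add hx0R]; ring_nf
    have h5 : (x : ℝ) ^ (1 + θ - σ₁ / 2) ≤ (x : ℝ) ^ (1 - σ₁ / 4) :=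
      Real.rpow_le_rpow_of_exponent_le hx1R (by linarith)
    have : (N : ℝ) = (⌊(M₀ : ℝ) * (x : ℝ) ^ (1 + θ - σ₁)⌋₊ : ℝ) + a₁.natAbs := by
      rw [hN]; push_cast; ring
    rw [this]; linarith
  set N' : ℕ := max N 2 with hN'
  have hN'2 : 2 ≤ N' := le_max_right _ _
  have hxp1 : (1 : ℝ) ≤ (x : ℝ) ^ (1 - σ₁ / 4) := Real.one_le_rpow hx1R hpos1.le
  have hN'le : (N' : ℝ) ≤ 2 * (x : ℝ) ^ (1 - σ₁ / 4) := by
    rcases le_total N 2 with h | h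
    · rw [hN', max_eq_right h]; push_cast; linarith
    · rw [hN', max_eq_left h]; exact hNle
  have hN'x : (N' : ℝ) ≤ x := by
    -- `2 x^{1-σ₁/4} ≤ x^{σ₁/4} x^{1-σ₁/4} = x`
    have : (x : ℝ) ^ (σ₁ / 4) * (x : ℝ) ^ (1 - σ₁ / 4) = x := by
      rw [← Real.rpow_add hx0R]; ring_nf; exact Real.rpow_one _
    nlinarith [Real.rpow_nonneg hx0R.le (1 - σ₁ / 4)]
  -- Step 3: enlarge the `n`-range to `Icc 1 N' = Ioc (N' - N') N'` and apply TAU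
  have hmono : ∑ n ∈ Finset.Icc 1 N,
      ((((q₀ * n + a₀).toNat).divisors.card : ℕ) : ℝ) * ((((q₁ * n + a₁).toNat).divisors.card : ℕ) : ℝ) ≤
      ∑ n ∈ Finset.Ioc (N' - N') N',
      ((((q₀ * n + a₀).toNat).divisors.card : ℕ) : ℝ) * ((((q₁ * n + a₁).toNat).divisors.card : ℕ) : ℝ) := by
    refine Finset.sum_le_sum_of_subset_of_nonneg ?_ (fun _ _ _ => by positivity)
    intro n hn
    rw [Finset.mem_Icc] at hn
    rw [Finset.mem_Ioc]
    refine ⟨by omega, hn.2.trans (le_max_left _ _)⟩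
  have hτ' := hτ N' N' hN'2 le_rfl
  have hlogN' : Real.log N' ≤ Real.log x :=
    Real.log_le_log (by exact_mod_cast (show 0 < N' by omega)) hN'x
  have hlogN'0 : 0 ≤ Real.log N' := Real.log_nonneg (by exact_mod_cast (show 1 ≤ N' by omega))
  have hpowlog : Real.log N' ^ c ≤ L ^ c := by
    exact pow_le_pow_left₀ hlogN'0 (hlogN'.trans (by linarith)) c
  have hN'34 : (N' : ℝ) ^ (3 / 4 : ℝ) ≤ N' := by
    have h1 : (1 : ℝ) ≤ N' := by exact_mod_cast (show 1 ≤ N' by omega)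
    calc (N' : ℝ) ^ (3 / 4 : ℝ) ≤ (N' : ℝ) ^ (1 : ℝ) := Real.rpow_le_rpow_of_exponent_le h1 (by norm_num)
      _ = N' := Real.rpow_one _
  have hXbL : 1 + Real.log Xb ≤ 3 * L := one_add_log_le_three_mul hx1 hXb1 hXb2
  have hXbL0 : 0 ≤ 1 + Real.log Xb := by
    have : 0 ≤ Real.log Xb := Real.log_nonneg (by exact_mod_cast hXb1); linarith
  -- assemble
  have hsum : ∑ n ∈ Finset.Icc 1 N,
      ((((q₀ * n + a₀).toNat).divisors.card : ℕ) : ℝ) * ((((q₁ * n + a₁).toNat).divisors.card : ℕ) : ℝ) ≤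
      Cτ * (2 * (x : ℝ) ^ (1 - σ₁ / 4) * L ^ c + 2 * (x : ℝ) ^ (1 - σ₁ / 4)) := by
    refine hmono.trans (hτ'.trans ?_)
    refine mul_le_mul_of_nonneg_left ?_ hCτ.le
    have hxpow0 : 0 ≤ (x : ℝ) ^ (1 - σ₁ / 4) := by positivity
    have hLc0 : 0 ≤ L ^ c := by positivity
    refine add_le_add ?_ (hN'34.trans hN'le)
    calc (N' : ℝ) * Real.log N' ^ c ≤ (2 * (x : ℝ) ^ (1 - σ₁ / 4)) * L ^ c :=
          mul_le_mul hN'le hpowlog (by positivity) (by positivity)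
      _ = 2 * (x : ℝ) ^ (1 - σ₁ / 4) * L ^ c := by ring
  have hxpow0 : 0 ≤ (x : ℝ) ^ (1 - σ₁ / 4) := by positivity
  have hLc1 : 1 ≤ L ^ c := one_le_pow₀ hL1
  calc (1 + Real.log Xb) ^ 2 * ∑ n ∈ Finset.Icc 1 N,
        ((((q₀ * n + a₀).toNat).divisors.card : ℕ) : ℝ) * ((((q₁ * n + a₁).toNat).divisors.card : ℕ) : ℝ)
      ≤ (3 * L) ^ 2 * (Cτ * (2 * (x : ℝ) ^ (1 - σ₁ / 4) * L ^ c + 2 * (x : ℝ) ^ (1 - σ₁ / 4))) := by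
        refine mul_le_mul (pow_le_pow_left₀ hXbL0 hXbL 2) hsum ?_ (by positivity)
        exact Finset.sum_nonneg fun _ _ => by positivity
    _ ≤ (3 * L) ^ 2 * (Cτ * (4 * (x : ℝ) ^ (1 - σ₁ / 4) * L ^ c)) := by
        refine mul_le_mul_of_nonneg_left (mul_le_mul_of_nonneg_left ?_ hCτ.le) (by positivity)
        nlinarith [mul_nonneg hxpow0 (sub_nonneg.mpr hLc1)]
    _ = 36 * Cτ * L ^ (c + 2) * (x : ℝ) ^ (1 - σ₁ / 4) := by ring


end MiddleAssembly

/-- **Auxiliary stub `stub_pair_middle_small_part`** (head of this helper file; parent stub `stub_pair_middle`):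
the small-cofactor part `m ≤ ⌊x^{σ₁/2}⌋₊` is `≪ (1+log x)^{c+2} x^{1−σ₁/4}` — `MiddleAssembly.small_part_le`. -/
theorem stub_pair_middle_small_part : ∀ (q₀ a₀ q₁ a₁ : ℤ), 0 < q₀ → 0 < q₁ → ∀ (σ₁ : ℝ), 0 < σ₁ → σ₁ < 1 →
    ∃ C : ℝ, 0 < C ∧ ∃ c : ℕ, ∃ X₀ : ℕ, ∀ (x Xb : ℕ) (σ₂ θ η : ℝ), X₀ ≤ x → θ ≤ σ₁ / 4 → 1 ≤ Xb → (Xb : ℝ) ≤ (x : ℝ) ^ 2 → |∑ d₀ ∈ Finset.Icc 1 Xb, ∑ d₁ ∈ Finset.Icc 1 Xb, ∑ m ∈ Finset.Icc 1 ⌊(x : ℝ) ^ (σ₁ / 2)⌋₊, (if ((d₁ : ℤ) * m - a₁) % q₁ = 0 ∧ (1 ≤ ((d₁ : ℤ) * m - a₁) / q₁ ∧ ((d₁ : ℤ) * m - a₁) / q₁ ≤ x) ∧ (1 ≤ q₀ * (((d₁ : ℤ) * m - a₁) / q₁) + a₀ ∧ (d₀ : ℤ) ∣ q₀ * (((d₁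 : ℤ) * m - a₁) / q₁) + a₀) ∧ ((x : ℝ) ^ (1 - η) < (d₀ : ℝ) * d₁ ∧ (d₀ : ℝ) * d₁ ≤ (x : ℝ) ^ (1 + θ) ∧ ((x : ℝ) ^ σ₁ < (d₀ : ℝ) ∧ (d₀ : ℝ) ≤ (x : ℝ) ^ σ₂)) then ((ArithmeticFunction.moebius d₀ : ℝ) * Real.log d₀) * ((ArithmeticFunction.moebius d₁ : ℝ) * Real.log d₁) else 0)| ≤ C * (1 + Real.log x) ^ (c + 2) * (x : ℝ) ^ (1 - σ₁ / 4) :=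
  fun _ _ _ _ hq₀ hq₁ _ hσ₁ hσ₁' => MiddleAssembly.small_part_le hq₀ hq₁ hσ₁ hσ₁'

end Summit.Parity.BatemanHorn.Theorems.PolyMobiusTail.EtaFreeWindow
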